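import Summits.ResolutionOfSingularities.ResolutionOfSingularities.Theorems.EquisingularLiftEquisingularLiftNatResidueHypDefsE3
import Summits.ResolutionOfSingularities.ResolutionOfSingularities.Theorems.EquisingularLiftEquisingularLiftNatHostedRoundSeam
import Summits.ResolutionOfSingularities.ResolutionOfSingularities.Theorems.EquisingularLiftEquisingularLiftNatConeRoundTransport
import Summits.ResolutionOfSingularities.ResolutionOfSingularities.Theorems.EquisingularLiftEquisingularLiftNatStrictTransformVanishingIdeal
import Summits.ResolutionOfSingularities.ResolutionOfSingularities.Theorems.EquisingularLiftEquisingularLiftNatRoundStrictTransformIso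
import Summits.ResolutionOfSingularities.ResolutionOfSingularities.Theorems.EquisingularLiftEquisingularLiftNatRoundSplitNodeTransport
import Literature.AlgebraicGeometry.Morphisms.SubschemeIntegral
import HarnessLib

/-!
# [OURS · L1 W4.5(b) · EL♮(3) · door ν4, D7 brick HSUBᵉ — supplier N-RD] `hrdz_rPlus`: THE EQUINODAL NOSE DATUM `R⁺` SURVIVES A ROUND OF THE HOST

res-type-027 g21 (desk res-L1-w45b-plan-1 g23, STATUS 2026-08-28T23:09Z (ii): «027 = HRDZ» = the N-RD supplier of ✓ `Equinodal.hsube_of_suppliers`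
(res-L1-w45b-nose-w1, p676659) at `RD := RPlus` of ✓ `…NatResidueHypDefsE3` (nose-w1; SIG draft 2 bdafbdfceaa7ae09 — this statement is that SIG's
`hrdz_rPlus` VERBATIM). Crux `EquisingularLiftNatThree` = stmt-ResolutionOfSingularities-20148 (parent stmt-…-20038), route `EquisingularLift`, line
`sections`. OURS; NOT a statement of any manuscript ([Hironaka2017] is a candidate under adjudication, nothing of it is asserted); AI-written, weaker
than expert review. EL♮(3) is NOT proved here. No `sorry`, no definition, no instance; standard axioms; the sorry-cone is F-88's alone, entering only
through the HYPOTHESIS `hFact : EmbeddedCurveLift O k θ P q`. `--supports stmt-ResolutionOfSingularities-20148 --as helper`.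

WHAT. In HSUBᵉ's director recursion a ROUND blows the current `Ch`-stage `X'` up along the (T-k)-centre `C ⊇ 𝓛` of the host letter through the
round's centre `Z' ⊆ closure E` (`C.comap j = 𝓘⟨Z'⟩`, `C` regular, flat, E1-legal). `hrdz_rPlus` says the motive `RPlus` (door-side facts + `Ch`-stage +
`NoseDatum`: host model `𝓛`, INTEGRAL nose model `𝓦 ≥ 𝓛`, node sections `𝔰 i` with marks `w i`, non-regular locus = marks, `SplitNodeAt` along each
section) passes from `(G, T, E, W)` to the round's `(G', T', E', W')` (closures of the preimages off `Z'`) with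
`𝓛₁ := St_τ 𝓛`, `𝓦₁ := St_τ 𝓦`, `𝔰₁ i :=` the lift of `𝔰 i` through `V(St 𝓦) ≅ V(𝓦)`, `w₁ i :=` the point of `G'` under `𝔰₁ i 𝔪`.

HOW (all by imported tree kit; this file is the assembly).
* stage: (T-k) `hFact` at the host model; E1-legality ✓ `image_support_subset_not_isGenericPoint_of_chain`; ✓ `exists_isBlowup`; ✓ `modelStep_chain`
  (the `Ch`-step, the model square `j₁, t₁`, `G'` integral, `T'` irreducible); frames ✓ `hFrame_of_ringKrullDim_redSub`; ✓ `isPullback_modelSquare_of_comm`;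
* host: ✓ `RoundIso.exists_iso_strictTransform_host` (res-type-027, p678235) + ✓ `comap_eq_vanishingIdeal_closure_of_iso_over` (trace, with density ✓
  `subset_closure_diff_of_flat_of_isEffectiveCartier`), ✓ `isPrincipal_stalkIdeal_strictTransformIdeal`, ✓ `Scheme.IsRegular.of_isOpenImmersion`,
  ✓ `comap_le_strictTransformIdeal` (off `Y`), ✓ `flat_strictTransform_subschemeι_comp_stage`;
* nose: ✓ `RoundIso.exists_iso_strictTransform_nose` (needs `¬ W ⊆ Z'` and `IsIntegral 𝓦.subscheme`), trace as above (density: a non-empty open part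
  of the irreducible `W`), ✓ `strictTransformIdeal_mono`, flatness as above, `IsIntegral.of_isIso`; sections lifted with `IsClosedImmersion.lift` through
  the nose iso; regularity off the sections and the «non-regular locus = marks» clause transported along the isos (✓ `exists_iso_subscheme_comap_of_iso_over`
  for the special fibres `W̃' ≅ W̃`); marks closed by ✓ `section_isClosedImmersion_and_isRegular_ker`; `W'` infinite/irreducible through `υ' '' W' = W`
  (✓ `image_support_comap_of_iso_over`) and `W̃' ≅ W̃` (✓ `irreducibleSpace_subscheme`);
* split nodes: ✓ `RoundIso.exists_splitNode_stalk_of_isos_over` (res-type-027, …NatRoundSplitNodeTransport: the package is a statement modulo the host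
  letter, and `A/𝓛_x ≅ A₁/(St 𝓛)_{x₁}`, `A/𝓦_x ≅ A₁/(St 𝓦)_{x₁}` even when the node lies ON the round's centre).

References: [StacksProject, Tags 080E, 0805, 02ND, 01WS]; [GortzWedhorn2020, Prop. 13.91, Prop. 13.96, Prop. 14.60]; tree kit (OURS, imported):
…NatResidueHypDefsE3 (res-L1-w45b-nose-w1), …NatHostedRoundSeam / …NatConeRoundTransport / …NatStrictTransformVanishingIdeal (res-D-pv-029 lineage,
res-L1-w45b-stub-1/2), …NatRoundStrictTransformIso / …NatRoundSplitNodeTransport (res-type-027).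
-/

set_option linter.dupNamespace false -- mandated namespace `Summit.<Summit>.<Problem>` of this single-conjunct summit
set_option linter.overlappingInstances false -- the SIG's signature carries `[IsDomain O] [IsDiscreteValuationRing O]`

noncomputable section

open CategoryTheory CategoryTheory.Limits AlgebraicGeometry TopologicalSpace Topology IsLocalRing
open Literature.AlgebraicGeometry.Resolution
open AlgebraicGeometry.Scheme.IdealSheafData
open Summit.ResolutionOfSingularities.ResolutionOfSingularities.Theses.EquisingularLift.Split
open Summit.ResolutionOfSingularities.ResolutionOfSingularities.Cruxes.EquisingularLift.StrataSplit

namespace Summit.ResolutionOfSingularities.ResolutionOfSingularities.Cruxes.EquisingularLiftNat.Sections.Equinodal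

/-- ★ **HRDZ — the equinodal nose datum `R⁺` survives a round of the host** (N-RD supplier of ✓ `hsube_of_suppliers` at `RD := RPlus`; statement =
res-L1-w45b-nose-w1's SIG draft 2 verbatim): from `RPlus … G γ T E W`, the round's hypotheses on `Z'` (inside `closure E` and `T`, not containing `W`
or `T`, `V(Z')` regular of stalk dimension `1` at closed points, regular inside `V(closure E)`, `DirStepUnobs`) and the blow-up `υ' : G' → G` of `Z'`,
the motive `RPlus` for `G'`, `υ' ≫ γ` and the closures of the preimages of `T ∖ Z'`, `closure E ∖ Z'`, `W ∖ Z'`. [OURS · conditional only through the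
hypothesis `hFact : EmbeddedCurveLift O k θ P q` (F-88)] -/
theorem hrdz_rPlus (k : Type) [Field k] [IsAlgClosed k]
    (O : Type) [CommRing O] [IsDomain O] [IsDiscreteValuationRing O] [IsAdicComplete (IsLocalRing.maximalIdeal O) O]
    [IsAlgClosed (IsLocalRing.ResidueField O)] (θ : O →+* k) (hθ : Function.Surjective θ)
    (P : Scheme.{0}) (q : P ⟶ Spec (.of O)) (Y : Set P) (Ch : ∀ X' : Scheme.{0}, (X' ⟶ P) → Set X' → Prop)
    (hChStep : ∀ (X' X'' : Scheme.{0}) (σ' : X' ⟶ P) (S' : Set X') (C : X'.IdealSheafData) (τ : X'' ⟶ X'),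
      Ch X' σ' S' → IsBlowup τ C → Scheme.IsRegular C.subscheme → Flat (C.subschemeι ≫ σ' ≫ q) →
      σ' '' (C.support : Set X') ⊆ {y | ¬ IsGenericPoint y Y} → (C.support : Set X') ∩ (σ' ≫ q) ⁻¹' {IsLocalRing.closedPoint O} ⊆ S' →
      Ch X'' (τ ≫ σ') (closure (τ ⁻¹' (S' \ (C.support : Set X')))))
    (hChSplit : ∀ (X' : Scheme.{0}) (σ' : X' ⟶ P) (S' : Set X'), Ch X' σ' S' → Chain P Y X' σ' S')
    (hYsp : Y ⊆ q ⁻¹' {IsLocalRing.closedPoint O}) (hYirr : IsIrreducible Y) (hYcl : IsClosed Y) (hPint : IsIntegral P)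
    (hPnoeth : IsLocallyNoetherian P) (hPreg : Scheme.IsRegular P) (hqprop : IsProper q) (hqsm : SmoothOfRelativeDimension 3 q)
    (hFact : EmbeddedCurveLift O k θ P q) :
        (∀ (G G' : Scheme.{0}) (γ : G ⟶ (Literature.AlgebraicGeometry.Motives.projectiveSpace 3 k).left) (T E W : Set G) (Z' : Set G) (hZ' : IsClosed Z') (υ' : G' ⟶ G),
          RPlus k O θ P q Y Ch G γ T E W → W ⊆ T → ¬ W ⊆ Z' → Z' ⊆ closure E → Z' ⊆ T → ¬ T ⊆ Z' → (∀ z : ↥(redSub G Z' hZ'), IsRegularLocalRing ((redSub G Z' hZ').presheaf.stalk z)) →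
          (∀ (i : redSub G Z' hZ' ⟶ redSub G (closure E) isClosed_closure), i ≫ redSubι G (closure E) isClosed_closure = redSubι G Z' hZ' →
            ∀ z : ↥(redSub G Z' hZ'), IsRegularLocalRing ((redSub G (closure E) isClosed_closure).presheaf.stalk (i z))) → DirStepUnobs G (closure E) isClosed_closure Z' hZ' →
          (∀ z : ↥(redSub G Z' hZ'), IsClosed ({z} : Set ↥(redSub G Z' hZ')) → ringKrullDim ((redSub G Z' hZ').presheaf.stalk z) = ((1 : ℕ) : WithBot ℕ∞)) →
          IsBlowup υ' (vanishingIdeal (⟨Z', hZ'⟩ : Closeds G)) →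
          RPlus k O θ P q Y Ch G' (υ' ≫ γ) (closure (υ' ⁻¹' (T \ Z'))) (closure (υ' ⁻¹' (closure E \ Z'))) (closure (υ' ⁻¹' (W \ Z')))) := by
  intro G G' γ T E W Z' hZ' υ' hRD hWT hWZ hZE hZT hTZ hZreg hEreg hunobs hZdim hυ'
  classical
  haveI := hPint; haveI := hPnoeth; haveI := hqprop; haveI := hqsm
  -- unpack `RPlus` and `NoseDatum`
  obtain ⟨hTcl, hTirr, hGint, -, hWinf, hWirr, hW, X', σ', S', j, t, hCh', hX'int, hX'noeth, hX'reg, hX'dom, hsq, hjT,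
    𝓛, 𝓦, m, 𝔰, w, hLtr, hLpr, hLreg, hLoff, hLfl, hLW, hWtr, hWfl, hWint, hWreg, h𝔰q, h𝔰W, hjw, hwinj, hwW, hwcl, hnonreg, hnode⟩ := hRD
  haveI := hGint; haveI := hX'int; haveI := hX'noeth; haveI := hWint
  -- properness of the stage over `O`
  have hch : Chain P Y X' σ' S' := hChSplit _ _ _ hCh'
  obtain ⟨-, -, hσ'prop⟩ := chain_isRegular P Y X' σ' S' hch hPnoeth hPreg
  haveI := hσ'prop
  have hLprop : IsProper (𝓛.subschemeι ≫ σ' ≫ q) := inferInstance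
  -- the host's model is not `⊥`
  have h𝓛0 : 𝓛 ≠ ⊥ := by
    obtain ⟨ξ, hξ⟩ : ∃ ξ : P, IsGenericPoint ξ Y := QuasiSober.sober hYirr hYcl
    obtain ⟨ξ', hfib', -⟩ := Chain.fibre hch hξ
    intro h0
    have hmem : ξ' ∈ (𝓛.support : Set X') := by rw [h0, Scheme.IdealSheafData.support_bot]; trivial
    have hgen : σ' ξ' = ξ := by
      have : ξ' ∈ σ' ⁻¹' {ξ} := by rw [hfib']; exact Set.mem_singleton ξ'
      exact this
    exact hLoff ⟨ξ', hmem, rfl⟩ (hgen ▸ hξ)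
  -- (T-k) AT THE HOST'S MODEL: the centre `C ⊇ 𝓛`
  obtain ⟨C, hLC, hCreg, hCfl, hCj, -⟩ := hFact X' σ' 𝓛 hX'int hX'noeth hX'reg hLreg hLfl hLprop G j t hsq (closure E)
    isClosed_closure hLtr Z' hZ' hZE hZreg hEreg hunobs
  -- E1-legality of `C`
  have hoff : σ' '' (C.support : Set X') ⊆ {y : P | ¬ IsGenericPoint y Y} :=
    image_support_subset_not_isGenericPoint_of_chain θ hθ q Y hYsp σ' S' hch j t hsq T hjT C Z' hZ' hCj hTZ
  -- blow up `C`; the `Ch`-stage and the model square for `υ'`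
  have hDT : (((vanishingIdeal (⟨Z', hZ'⟩ : Closeds G)) : G.IdealSheafData).support : Set G) ⊆ T := by
    rw [Scheme.IdealSheafData.coe_support_vanishingIdeal]; exact hZT
  have hTD : ¬ T ⊆ (((vanishingIdeal (⟨Z', hZ'⟩ : Closeds G)) : G.IdealSheafData).support : Set G) := by
    rw [Scheme.IdealSheafData.coe_support_vanishingIdeal]; exact hTZ
  obtain ⟨X₁, τ, hτ⟩ := exists_isBlowup X' C
  obtain ⟨hX₁i, hX₁n, hX₁r, hX₁dom, hG'i, hirr₁, j₁, t₁, hsq₁, hcomm₁, hCh₁⟩ :=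
    modelStep_chain O k θ hθ P q Y hYirr hYcl Ch hChSplit hChStep X' σ' S' hCh' hX'reg hX'dom G j t hsq T hjT
      C (vanishingIdeal (⟨Z', hZ'⟩ : Closeds G)) hCj hCreg hCfl hoff hDT hTD X₁ τ hτ G' υ' hυ'
  rw [Scheme.IdealSheafData.coe_support_vanishingIdeal] at hirr₁ hCh₁
  haveI := hX₁i; haveI := hX₁n; haveI := hG'i
  -- the frames of `C` (a relative curve)
  have hfr : ∀ x ∈ C.support, ∃ c : Fin 2 → X'.presheaf.stalk x, Ideal.span (Set.range c) = stalkIdeal C x ∧ IsQuasiRegular c :=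
    hFrame_of_ringKrullDim_redSub O k θ hθ P q Y hYirr hYcl hPnoeth hPreg Ch hChSplit T Z' hZ' hZdim X' σ' S' j t C hCh' hX'int hX'noeth
      hX'reg hX'dom hsq hjT hCj hCfl hCreg
  -- the cartesian model square
  have hsqP : IsPullback j₁ υ' τ j := isPullback_modelSquare_of_comm O k θ hθ q σ' j t hsq τ υ' j₁ t₁ hsq₁ hcomm₁
  have hsup : 𝓛 ⊔ C = C := sup_eq_right.mpr hLC
  have hC0 : C ≠ ⊥ := fun h => h𝓛0 (le_bot_iff.mp (h ▸ hLC))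
  have h𝓛nz : ∀ x ∈ C.support, stalkIdeal 𝓛 x ≠ ⊥ := fun x _ => stalkIdeal_ne_bot_of_ne_bot h𝓛0 x
  -- THE HOST `St 𝓛`: iso over `τ`, the five clauses
  have hLcart : IsEffectiveCartier (C.comap 𝓛.subschemeι) :=
    isEffectiveCartier_comap_subschemeι_of_le_of_frames hX'reg 𝓛 C hLC hLpr hLreg hfr h𝓛nz
  obtain ⟨eL, heL⟩ := RoundIso.exists_iso_strictTransform_host hX'reg 𝓛 C hLC hLpr hLreg hfr h𝓛nz hτ
  have hdenseE : closure E ⊆ closure (closure E \ Z') :=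
    subset_closure_diff_of_flat_of_isEffectiveCartier θ hθ q σ' j t hsq 𝓛 C isClosed_closure hZ' hLtr (by rw [hsup]; exact hCj)
      (hsup.symm ▸ hCfl) hLcart
  have ho1 : (strictTransformIdeal τ C 𝓛).comap j₁ = vanishingIdeal (⟨closure (υ' ⁻¹' (closure E \ Z')), isClosed_closure⟩ : Closeds G') :=
    comap_eq_vanishingIdeal_closure_of_iso_over hsqP _ _ eL heL ⟨closure E, isClosed_closure⟩ ⟨Z', hZ'⟩ hLtr hυ' hdenseE
  have ho2 : ∀ z : X₁, (stalkIdeal (strictTransformIdeal τ C 𝓛) z).IsPrincipal := fun z =>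
    isPrincipal_stalkIdeal_strictTransformIdeal hX'reg hCreg hτ hC0 𝓛 hLpr z
  have ho3 : Scheme.IsRegular (strictTransformIdeal τ C 𝓛).subscheme := Scheme.IsRegular.of_isOpenImmersion eL.hom hLreg
  have ho4 : (τ ≫ σ') '' ((strictTransformIdeal τ C 𝓛).support : Set X₁) ⊆ {p : P | ¬ IsGenericPoint p Y} := by
    rintro _ ⟨z, hz, rfl⟩
    have hz' : z ∈ ((𝓛.comap τ).support : Set X₁) :=
      Scheme.IdealSheafData.support_antitone (comap_le_strictTransformIdeal τ C 𝓛) hz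
    rw [Scheme.IdealSheafData.support_comap] at hz'
    exact hLoff ⟨τ z, hz', rfl⟩
  have ho5 : Flat ((strictTransformIdeal τ C 𝓛).subschemeι ≫ (τ ≫ σ') ≫ q) :=
    flat_strictTransform_subschemeι_comp_stage O σ' q τ C hτ 𝓛 hLfl
  -- THE NOSE `St 𝓦`: iso over `τ` (integral nose, generic point off `V(C)` since `¬ W ⊆ Z'`)
  have hηW : 𝓦.subschemeι (genericPoint 𝓦.subscheme) ∉ C.support := by
    refine RoundIso.genericPoint_not_mem_support_of_not_range_subset 𝓦.subschemeι C fun hsub => hWZ ?_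
    intro g hg
    have hg' : j g ∈ (𝓦.support : Set X') := by
      have h2 : g ∈ ((𝓦.comap j).support : Set G) := by rw [hWtr, Scheme.IdealSheafData.coe_support_vanishingIdeal]; exact hg
      rw [Scheme.IdealSheafData.support_comap] at h2; exact h2
    have hgC : j g ∈ (C.support : Set X') := hsub (by rw [range_subschemeι]; exact hg')
    have : g ∈ ((C.comap j).support : Set G) := by rw [Scheme.IdealSheafData.support_comap]; exact hgC
    rwa [hCj, Scheme.IdealSheafData.coe_support_vanishingIdeal] at this
  obtain ⟨eW, heW⟩ := RoundIso.exists_iso_strictTransform_nose hX'reg 𝓛 C hLC hLpr hLreg hfr h𝓛nz 𝓦 hLW hηW hτ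
  have hdenseW : W ⊆ closure (W \ Z') := by
    rw [Set.sdiff_eq]
    refine subset_closure_inter_of_isPreirreducible_of_isOpen hWirr.isPreirreducible hZ'.isOpen_compl ?_
    by_contra hemp
    apply hWZ
    intro x hx
    by_contra hxZ
    exact hemp ⟨x, hx, hxZ⟩
  have hw1 : (strictTransformIdeal τ C 𝓦).comap j₁ = vanishingIdeal (⟨closure (υ' ⁻¹' (W \ Z')), isClosed_closure⟩ : Closeds G') :=
    comap_eq_vanishingIdeal_closure_of_iso_over hsqP _ _ eW heW ⟨W, hW⟩ ⟨Z', hZ'⟩ hWtr hυ' hdenseW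
  have hw2 : strictTransformIdeal τ C 𝓛 ≤ strictTransformIdeal τ C 𝓦 := strictTransformIdeal_mono τ C hLW
  have hw3 : Flat ((strictTransformIdeal τ C 𝓦).subschemeι ≫ (τ ≫ σ') ≫ q) :=
    flat_strictTransform_subschemeι_comp_stage O σ' q τ C hτ 𝓦 hWfl
  have hw4 : IsIntegral (strictTransformIdeal τ C 𝓦).subscheme := IsIntegral.of_isIso eW.inv
  -- SECTIONS of the round stage: `𝔰 i` lifted through `V(𝓦) ≅ V(St 𝓦)`
  haveI : IsProper τ := hτ.isProper
  haveI hsep₁ : IsSeparated ((τ ≫ σ') ≫ q) := inferInstance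
  haveI : IsClosedImmersion (Spec.map (CommRingCat.ofHom θ)) := IsClosedImmersion.spec_of_surjective _ hθ
  haveI : IsClosedImmersion j := MorphismProperty.IsStableUnderBaseChange.of_isPullback hsq.flip inferInstance
  haveI : IsClosedImmersion j₁ := MorphismProperty.IsStableUnderBaseChange.of_isPullback hsq₁.flip inferInstance
  have hk𝔰 : ∀ i, 𝓦.subschemeι.ker ≤ (𝔰 i).ker := fun i => by rw [Scheme.IdealSheafData.ker_subschemeι]; exact h𝔰W i
  obtain ⟨𝔰v, h𝔰v⟩ : ∃ 𝔰v : Fin m → (Spec (.of O) ⟶ 𝓦.subscheme), ∀ i, 𝔰v i ≫ 𝓦.subschemeι = 𝔰 i :=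
    ⟨fun i => IsClosedImmersion.lift 𝓦.subschemeι (𝔰 i) (hk𝔰 i), fun i => IsClosedImmersion.lift_fac _ _ _⟩
  obtain ⟨𝔰₁, h𝔰₁⟩ : ∃ 𝔰₁ : Fin m → (Spec (.of O) ⟶ X₁), ∀ i, 𝔰₁ i = 𝔰v i ≫ eW.inv ≫ (strictTransformIdeal τ C 𝓦).subschemeι :=
    ⟨fun i => 𝔰v i ≫ eW.inv ≫ (strictTransformIdeal τ C 𝓦).subschemeι, fun _ => rfl⟩
  have h𝔰₁τ : ∀ i, 𝔰₁ i ≫ τ = 𝔰 i := fun i => by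
    rw [h𝔰₁, Category.assoc, Category.assoc, ← heW, eW.inv_hom_id_assoc, h𝔰v]
  have h𝔰₁q : ∀ i, 𝔰₁ i ≫ (τ ≫ σ') ≫ q = 𝟙 _ := fun i => by
    have := h𝔰q i
    rw [← h𝔰₁τ i] at this
    simpa only [Category.assoc] using this
  have h𝔰₁W : ∀ i, strictTransformIdeal τ C 𝓦 ≤ (𝔰₁ i).ker := fun i => by
    rw [h𝔰₁, ← Category.assoc]
    exact (Scheme.IdealSheafData.ker_subschemeι (I := strictTransformIdeal τ C 𝓦)).ge.trans (Scheme.Hom.le_ker_comp _ _)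
  -- points: `ι₁ (eW.inv y) ↦ ι y` under `τ`, `𝔰₁ i p = ι₁ (eW.inv (𝔰v i p))`
  have hιτ : ∀ y : ↥𝓦.subscheme, τ ((strictTransformIdeal τ C 𝓦).subschemeι (eW.inv y)) = 𝓦.subschemeι y := fun y => by
    rw [← Scheme.Hom.comp_apply, ← Scheme.Hom.comp_apply, ← heW, eW.inv_hom_id_assoc]
  have h𝔰₁pt : ∀ i p, 𝔰₁ i p = (strictTransformIdeal τ C 𝓦).subschemeι (eW.inv (𝔰v i p)) := fun i p => by
    rw [h𝔰₁, Scheme.Hom.comp_apply, Scheme.Hom.comp_apply]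
  -- REGULAR OFF THE SECTIONS (transport along `eW`)
  have hWreg₁ : ∀ x : ↥(strictTransformIdeal τ C 𝓦).subscheme, (∀ i, (strictTransformIdeal τ C 𝓦).subschemeι x ∉ Set.range (𝔰₁ i)) →
      IsRegularLocalRing ((strictTransformIdeal τ C 𝓦).subscheme.presheaf.stalk x) := by
    intro x hx
    have hy : ∀ i, 𝓦.subschemeι (eW.hom x) ∉ Set.range (𝔰 i) := by
      rintro i ⟨p, hp⟩
      refine hx i ⟨p, ?_⟩
      have h1 : 𝓦.subschemeι (𝔰v i p) = 𝓦.subschemeι (eW.hom x) := by rw [← Scheme.Hom.comp_apply, h𝔰v]; exact hp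
      have h2 : 𝔰v i p = eW.hom x := 𝓦.subschemeι.isClosedEmbedding.injective h1
      rw [h𝔰₁pt, h2, Scheme.hom_inv_apply]
    haveI := hWreg (eW.hom x) hy
    exact IsRegularLocalRing.of_ringEquiv (R := 𝓦.subscheme.presheaf.stalk (eW.hom x)) (asIso (eW.hom.stalkMap x)).commRingCatIsoToRingEquiv
  -- MARKS `w₁ i`: the closed points of `G'` under the sections
  have hrange₁ : Set.range j₁ = ((τ ≫ σ') ≫ q) ⁻¹' {IsLocalRing.closedPoint O} := by
    rw [range_eq_preimage_of_isPullback hsq₁, range_specMap_of_surjective_of_field θ hθ]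
  have hmem₁ : ∀ i, 𝔰₁ i (IsLocalRing.closedPoint O) ∈ Set.range j₁ := fun i => by
    rw [hrange₁]
    show ((τ ≫ σ') ≫ q) (𝔰₁ i (IsLocalRing.closedPoint O)) = IsLocalRing.closedPoint O
    rw [← Scheme.Hom.comp_apply, h𝔰₁q]; rfl
  choose w₁ hw₁ using hmem₁
  have hjinj : Function.Injective j := j.isClosedEmbedding.injective
  have hj₁inj : Function.Injective j₁ := j₁.isClosedEmbedding.injective
  have hυw : ∀ i, υ' (w₁ i) = w i := fun i => by
    apply hjinj
    rw [hjw, ← Scheme.Hom.comp_apply, ← hcomm₁, Scheme.Hom.comp_apply, hw₁, ← Scheme.Hom.comp_apply, h𝔰₁τ]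
  have hw₁inj : Function.Injective w₁ := fun i i' h => hwinj (by rw [← hυw, ← hυw, h])
  have hw₁W : ∀ i, w₁ i ∈ closure (υ' ⁻¹' (W \ Z')) := fun i => by
    have h1 : w₁ i ∈ (((strictTransformIdeal τ C 𝓦).comap j₁).support : Set G') := by
      rw [Scheme.IdealSheafData.support_comap]
      show j₁ (w₁ i) ∈ ((strictTransformIdeal τ C 𝓦).support : Set X₁)
      rw [hw₁, ← range_subschemeι, h𝔰₁pt]
      exact ⟨_, rfl⟩
    rwa [hw1, Scheme.IdealSheafData.coe_support_vanishingIdeal] at h1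
  have hw₁cl : ∀ i, IsClosed ({w₁ i} : Set G') := fun i => by
    have hc := (section_isClosedImmersion_and_isRegular_ker O X₁ ((τ ≫ σ') ≫ q) (𝔰₁ i) (h𝔰₁q i)).2.2.1
    have heq : ({w₁ i} : Set G') = j₁ ⁻¹' {𝔰₁ i (IsLocalRing.closedPoint O)} := by
      ext g
      simp only [Set.mem_singleton_iff, Set.mem_preimage]
      exact ⟨fun h => h ▸ hw₁ i, fun h => hj₁inj (h.trans (hw₁ i).symm)⟩
    rw [heq]; exact hc.preimage j₁.continuous
  -- DOOR-SIDE facts for `W' ⊆ T'`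
  have hWT' : closure (υ' ⁻¹' (W \ Z')) ⊆ closure (υ' ⁻¹' (T \ Z')) :=
    closure_mono (Set.preimage_mono (Set.sdiff_subset_sdiff_left hWT))
  have himW : υ' '' closure (υ' ⁻¹' (W \ Z')) = W := by
    have := image_support_comap_of_iso_over hsqP _ _ eW heW
    rwa [hw1, hWtr, Scheme.IdealSheafData.coe_support_vanishingIdeal, Scheme.IdealSheafData.coe_support_vanishingIdeal] at this
  have hWinf' : (closure (υ' ⁻¹' (W \ Z'))).Infinite := fun hfin => hWinf (himW ▸ hfin.image _)
  have hWirr' : IsIrreducible (closure (υ' ⁻¹' (W \ Z'))) := by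
    obtain ⟨eG, -⟩ := exists_iso_subscheme_comap_of_iso_over hsqP _ _ eW heW
    haveI : IrreducibleSpace ↥(𝓦.comap j).subscheme := Literature.AlgebraicGeometry.Morphisms.irreducibleSpace_subscheme _
      (by rw [hWtr, Scheme.IdealSheafData.coe_support_vanishingIdeal]; exact hWirr)
    have h1 : IsIrreducible (Set.range ⇑(eG.inv ≫ ((strictTransformIdeal τ C 𝓦).comap j₁).subschemeι)) := by
      rw [← Set.image_univ]
      exact (IrreducibleSpace.isIrreducible_univ _).image _ (Scheme.Hom.continuous _).continuousOn
    have h2 : ⇑(eG.inv ≫ ((strictTransformIdeal τ C 𝓦).comap j₁).subschemeι) = ⇑((strictTransformIdeal τ C 𝓦).comap j₁).subschemeι ∘ ⇑eG.inv :=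
      funext fun y => Scheme.Hom.comp_apply _ _ y
    have hsurj : Function.Surjective eG.inv.base := eG.inv.homeomorph.surjective
    rw [h2, hsurj.range_comp, range_subschemeι, hw1, Scheme.IdealSheafData.coe_support_vanishingIdeal] at h1
    exact h1
  -- THE NON-REGULAR LOCUS of `W̃'` = the marks (transport along `W̃' ≅ W̃` over `υ'`)
  have hnonreg₁ : ∀ z : ↥(redSub G' (closure (υ' ⁻¹' (W \ Z'))) isClosed_closure), IsClosed ({z} : Set _) →
      (¬ IsRegularLocalRing ((redSub G' (closure (υ' ⁻¹' (W \ Z'))) isClosed_closure).presheaf.stalk z) ↔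
        ∃ i, (redSubι G' (closure (υ' ⁻¹' (W \ Z'))) isClosed_closure z : G') = w₁ i) := by
    obtain ⟨eG, heG⟩ := exists_iso_subscheme_comap_of_iso_over hsqP (strictTransformIdeal τ C 𝓦) 𝓦 eW heW
    revert eG
    rw [hw1, hWtr]
    intro eG heG z hz
    have hpt : ∀ z', υ' (redSubι G' _ isClosed_closure z') = redSubι G W hW (eG.hom z') := fun z' => by
      rw [← Scheme.Hom.comp_apply, ← heG, Scheme.Hom.comp_apply]
    have hzc : IsClosed ({eG.hom z} : Set _) := by
      have := eG.hom.homeomorph.isClosedMap _ hz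
      rwa [Set.image_singleton, Scheme.Hom.homeomorph_apply] at this
    have hregiff : IsRegularLocalRing ((redSub G' (closure (υ' ⁻¹' (W \ Z'))) isClosed_closure).presheaf.stalk z) ↔
        IsRegularLocalRing ((redSub G W hW).presheaf.stalk (eG.hom z)) := by
      constructor
      · intro h
        haveI := h
        exact IsRegularLocalRing.of_ringEquiv (R := (redSub G' (closure (υ' ⁻¹' (W \ Z'))) isClosed_closure).presheaf.stalk z)
          (asIso (eG.hom.stalkMap z)).commRingCatIsoToRingEquiv.symm
      · intro h
        haveI := h
        exact IsRegularLocalRing.of_ringEquiv (R := (redSub G W hW).presheaf.stalk (eG.hom z)) (asIso (eG.hom.stalkMap z)).commRingCatIsoToRingEquiv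
    rw [not_congr hregiff, hnonreg (eG.hom z) hzc]
    constructor
    · rintro ⟨i, hi⟩
      refine ⟨i, ?_⟩
      obtain ⟨z₁, hz₁⟩ : w₁ i ∈ Set.range (redSubι G' (closure (υ' ⁻¹' (W \ Z'))) isClosed_closure) := by
        rw [range_subschemeι, Scheme.IdealSheafData.coe_support_vanishingIdeal]; exact hw₁W i
      have h1 : redSubι G W hW (eG.hom z₁) = redSubι G W hW (eG.hom z) := by rw [← hpt, hz₁, hυw, ← hi]
      have h2 : z₁ = z := eG.hom.homeomorph.injective ((redSubι G W hW).isClosedEmbedding.injective h1)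
      rw [← hz₁, h2]
    · rintro ⟨i, hi⟩
      exact ⟨i, by rw [← hpt, hi, hυw]⟩
  -- SPLIT NODES along the lifted sections
  have hnode₁ : ∀ i, SplitNodeAt X₁ (strictTransformIdeal τ C 𝓛) (strictTransformIdeal τ C 𝓦) (𝔰₁ i).ker (𝔰₁ i (IsLocalRing.closedPoint O)) := by
    intro i
    haveI : IsClosedImmersion ((strictTransformIdeal τ C 𝓛).subschemeι ≫ τ) := by rw [← heL]; infer_instance
    haveI : IsSeparated (σ' ≫ q) := inferInstance
    haveI : IsClosedImmersion (𝔰 i) := (section_isClosedImmersion_and_isRegular_ker O X' (σ' ≫ q) (𝔰 i) (h𝔰q i)).1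
    haveI : IsClosedImmersion (𝔰₁ i) := (section_isClosedImmersion_and_isRegular_ker O X₁ ((τ ≫ σ') ≫ q) (𝔰₁ i) (h𝔰₁q i)).1
    have hxW : 𝔰₁ i (IsLocalRing.closedPoint O) ∈ ((strictTransformIdeal τ C 𝓦).support : Set X₁) := by
      rw [← range_subschemeι, h𝔰₁pt]; exact ⟨_, rfl⟩
    have h0 : SplitNodeAt X' 𝓛 𝓦 (𝔰 i).ker (τ (𝔰₁ i (IsLocalRing.closedPoint O))) := by
      have : τ (𝔰₁ i (IsLocalRing.closedPoint O)) = 𝔰 i (IsLocalRing.closedPoint O) := by rw [← Scheme.Hom.comp_apply, h𝔰₁τ]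
      rw [this]; exact hnode i
    exact RoundIso.exists_splitNode_stalk_of_isos_over τ 𝓛 𝓦 _ _ (comap_le_strictTransformIdeal τ C 𝓛) hw2 eW heW (𝔰₁ i) (𝔰 i) (h𝔰₁τ i)
      (h𝔰₁W i) _ _ rfl hxW h0
  -- ASSEMBLY
  have ho1' : (strictTransformIdeal τ C 𝓛).comap j₁ =
      vanishingIdeal (⟨closure (closure (υ' ⁻¹' (closure E \ Z'))), isClosed_closure⟩ : Closeds G') := by
    rw [ho1]; congr 1; exact Closeds.ext closure_closure.symm
  exact ⟨isClosed_closure, hirr₁, hG'i, hWT', hWinf', hWirr', isClosed_closure, X₁, τ ≫ σ', _, j₁, t₁, hCh₁, hX₁i, hX₁n, hX₁r, hX₁dom, hsq₁, rfl,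
    strictTransformIdeal τ C 𝓛, strictTransformIdeal τ C 𝓦, m, 𝔰₁, w₁, ho1', ho2, ho3, ho4, ho5, hw2, hw1, hw3, hw4, hWreg₁, h𝔰₁q, h𝔰₁W, hw₁,
    hw₁inj, hw₁W, hw₁cl, hnonreg₁, hnode₁⟩

end Summit.ResolutionOfSingularities.ResolutionOfSingularities.Cruxes.EquisingularLiftNat.Sections.Equinodal

end
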